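import Summits.CriticalPhenomena.PercolationContinuityZ3.Theorems.PercNearOneGluingAdditiveGluingSurplusTransfer
import Summits.CriticalPhenomena.PercolationContinuityZ3.Theorems.PercNearOneGluingNoHeavyLowerTailGuardedLonelyRelay
import Literature.Probability.Percolation.TwoSetConditionalAssociation
import HarnessLib

/-!
# Crux `PercNearOneGluing.AdditiveGluing` (stmt-CriticalPhenomena-4576): covariance transfer across a relay SET — the 'A-part' of the
# surplus-transfer inequality (S5)

Support file (`--supports stmt-CriticalPhenomena-4576`, lead-of-record prim-png-lead-4576 gen 8).  No named facts, no sorries, no definitions.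

For a relay set `T`, a relay `a ∈ T`, observers `o` and `v`, and `F` monotone nonnegative on vertex sets (`m_a = ∫ F(C(a))`):
  `μ({v ↮ T} ∩ {o ↔ v}) · Cov(F(C_a), 1_{v ↔ T}) ≤ μ(v ↮ T) · Cov(F(C_a), 1_{o ↔ T})`     (`covTransfer_relaySet`),
i.e. `Cov(F(C_a), 1_{o↔T}) ≥ μ(o ↔ v | v ↮ T)·Cov(F(C_a), 1_{v↔T})`.  For `T = {a}` this is the tree's `AGloc.surplusTransfer_single` ((S5)₁).
Proof: the identity `μ(D)·Cov(f_a,1_{o↔T}) − μ(D∩{o↔v})·Cov(f_a,1_{v↔T}) = μ(D)·Cov(f_a, 1_{o ↔ T ∪ {v}}) − [μ(D)·E(f_a 1_{o↔v}; D) − μ(D∩{o↔v})·E(f_a; D)]`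
(`D = {v ↮ T}`; `{o ↔ T} ⊔ ({o ↔ v} ∩ D) = {o ↔ T ∪ {v}}`, `E(f_a; D) = m_a − E(f_a; v ↔ T)`), Harris for the first term, and the two-SET BHK inequality
(vdBHK 2006, Thm. 1.5 with sets / Thm. 2.1 at q = 1: `F(C_a)` is increasing in the edge cluster of the set `T ∋ a`, `{o ↔ v}` is increasing in the
edge cluster of `v`, and the two are negatively correlated given `v ↮ T`) for the bracket.
ROLE: with `Sur_x(T) = Cov(F(C_{a₁}), 1_{x↔T}) + Γ_x(T)` (`a₁` the least-`m` relay), (S5)_T splits into this PROVED 'A-transfer' and the open 'Γ-transfer'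
(lead memo LeadMath-g8 §7).
[cite: VandenbergHaggstromKahn2005, Thm. 1.5 (p. 7), Thm. 2.1 (p. 9), Remark 1 after Thm. 1.2 (p. 5)]
-/

noncomputable section

namespace Summit.CriticalPhenomena.PercolationContinuityZ3.Theorems.AGloc

open MeasureTheory Set
open Literature.Probability.LatticeModels (prodBernoulli)
open Literature.Probability.Percolation Literature.Probability.Percolation.KNPreFKG

variable {V : Type*} [Fintype V]

omit [Fintype V] in
/-- The vertex span of `a` in an edge set `W`: `a` together with everything `W`-reachable from `a`; monotone in `W`. [folklore] -/
theorem monotone_spanFun (a : V) (F : Set V → ℝ) (hF : ∀ S S' : Set V, S ⊆ S' → F S ≤ F S') :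
    Monotone fun W : Set (Sym2 V) => F {y | y = a ∨ (SimpleGraph.fromEdgeSet W).Reachable a y} := by
  intro W W' hWW'
  refine hF _ _ fun y hy => ?_
  rcases hy with h | h
  · exact Or.inl h
  · exact Or.inr (h.mono (SimpleGraph.fromEdgeSet_mono hWW'))

omit [Fintype V] in
/-- At the edge cluster of a set `T ∋ a`, the vertex span of `a` is the open cluster of `a`. [folklore] -/
theorem spanFun_biUnion_openEdgeCluster (T : Set V) {a : V} (ha : a ∈ T) (F : Set V → ℝ) (ω : BondConfig V) :
    F {y | y = a ∨ (SimpleGraph.fromEdgeSet (⋃ t ∈ T, openEdgeCluster ω t)).Reachable a y} = F (openCluster ω a) := by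
  congr 1
  ext y
  simp only [mem_setOf_eq, openCluster]
  constructor
  · rintro (rfl | h)
    · exact SimpleGraph.Reachable.refl _
    · have hsub : (⋃ t ∈ T, openEdgeCluster ω t) ⊆ ω := Set.iUnion₂_subset fun s _ => openEdgeCluster_subset ω s
      exact h.mono (SimpleGraph.fromEdgeSet_mono hsub)
  · intro h
    exact Or.inr ((GuardedLonelyRelay.reachable_fromEdgeSet_openEdgeCluster h).mono
      (SimpleGraph.fromEdgeSet_mono (Set.subset_biUnion_of_mem ha)))

/-- **Covariance transfer across a relay set (the A-part of (S5)).**  For `a ∈ T`, `F` monotone nonnegative on vertex sets (if `v ∈ T` both sides vanish),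
`m = ∫ F(C(a))`, `D = {v ↮ T}`:
`μ(D ∩ {o ↔ v}) · (∫_{v ↔ T} F(C(a)) − μ(v ↔ T)·m) ≤ μ(D) · (∫_{o ↔ T} F(C(a)) − μ(o ↔ T)·m)`.
[cite: VandenbergHaggstromKahn2005, Thm. 1.5 (p. 7) with Remark 1 after Thm. 1.2 (p. 5)] -/
theorem covTransfer_relaySet (w : Sym2 V → unitInterval) (T : Finset V) (o v a : V) (haT : a ∈ T)
    (F : Set V → ℝ) (hF : ∀ S S' : Set V, S ⊆ S' → F S ≤ F S') (hF0 : ∀ S, 0 ≤ F S) :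
    (prodBernoulli w).real ({ω : BondConfig V | ∀ t ∈ T, ¬ (openGraph ω).Reachable v t} ∩ openConn o v) *
        (∫ ω in (⋃ t ∈ T, openConn v t), F (openCluster ω a) ∂(prodBernoulli w) -
          (prodBernoulli w).real (⋃ t ∈ T, openConn v t) * ∫ ω, F (openCluster ω a) ∂(prodBernoulli w)) ≤
      (prodBernoulli w).real {ω : BondConfig V | ∀ t ∈ T, ¬ (openGraph ω).Reachable v t} *
        (∫ ω in (⋃ t ∈ T, openConn o t), F (openCluster ω a) ∂(prodBernoulli w) -
          (prodBernoulli w).real (⋃ t ∈ T, openConn o t) * ∫ ω, F (openCluster ω a) ∂(prodBernoulli w)) := by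
  classical
  set μ := prodBernoulli w with hμ
  set f : BondConfig V → ℝ := fun ω => F (openCluster ω a) with hf
  set m : ℝ := ∫ ω, f ω ∂μ with hm
  have hmeas : ∀ S : Set (BondConfig V), MeasurableSet S := fun _ => MeasurableSet.of_discrete
  have hint : ∀ (k : BondConfig V → ℝ) (S : Set (BondConfig V)), IntegrableOn k S μ :=
    fun k S => (Integrable.of_finite).integrableOn
  have hn := fun (S : Set (BondConfig V)) => (measureReal_nonneg : 0 ≤ μ.real S)
  set D : Set (BondConfig V) := {ω | ∀ t ∈ T, ¬ (openGraph ω).Reachable v t} with hD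
  set OT : Set (BondConfig V) := ⋃ t ∈ T, openConn o t with hOT
  set Ov : Set (BondConfig V) := openConn o v with hOv
  set Q : Set (BondConfig V) := ⋃ t ∈ T, openConn v t with hQ
  set U : Set (BondConfig V) := OT ∪ Ov with hU
  -- (1) Harris on `U`
  have hupT : IsUpperSet OT := isUpperSet_iUnion₂ fun t _ => isUpperSet_openConn o t
  have hHarris : μ.real U * m ≤ ∫ ω in U, f ω ∂μ :=
    setIntegral_clusterFun_ge w a F hF hF0 U (hupT.union (isUpperSet_openConn o v))
  -- (2) two-set BHK: `F(C_a)` (increasing in `C_T`) and `{o ↔ v}` (increasing in `C_v`) are negatively correlated given `v ↮ T`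
  have hind : ∀ ω : BondConfig V, (connFamily v o).indicator (1 : Set (Sym2 V) → ℝ) (⋃ s ∈ ({v} : Set V), openEdgeCluster ω s) =
      Ov.indicator (1 : BondConfig V → ℝ) ω := fun ω => by
    rw [biUnion_singleton, congrFun (indicator_comp_openEdgeCluster (connFamily v o) v) ω, ← openConn_eq_setOf_connFamily,
      openConn_symm v o]
  have hprod : ∀ (S : Set (BondConfig V)) (k : BondConfig V → ℝ),
      ∫ ω in D, S.indicator (1 : BondConfig V → ℝ) ω * k ω ∂μ = ∫ ω in D ∩ S, k ω ∂μ := by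
    intro S k
    rw [← setIntegral_mul_indicator_one μ D S k]
    refine setIntegral_congr_fun (hmeas D) fun ω _ => ?_
    ring
  have hDset : {ω : BondConfig V | ∀ s ∈ ({v} : Set V), ∀ t ∈ (↑T : Set V), ¬ (openGraph ω).Reachable s t} = D := by
    ext ω; simp [hD]
  have hBHK := BHK2006_twoSetConditionalAssociation.negCorrelation w ({v} : Set V) (↑T : Set V)
    ((connFamily v o).indicator 1) (fun W => F {y | y = a ∨ (SimpleGraph.fromEdgeSet W).Reachable a y})
    (monotone_indicator_one_of_isUpperSet (isUpperSet_connFamily v o)) (monotone_spanFun a F hF)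
  simp only [hDset, hind, spanFun_biUnion_openEdgeCluster (↑T : Set V) (Finset.mem_coe.2 haT)] at hBHK
  rw [setIntegral_indicator_one_eq, hprod Ov] at hBHK
  change μ.real D * ∫ ω in D ∩ Ov, f ω ∂μ ≤ μ.real (D ∩ Ov) * ∫ ω in D, f ω ∂μ at hBHK
  -- (3) `U = OT ⊔ (D ∩ Ov)`
  have hUdiff : U \ OT = D ∩ Ov := by
    ext ω
    simp only [hU, hOT, hOv, hD, mem_sdiff, mem_union, mem_iUnion, mem_inter_iff, exists_prop, not_exists, not_and, openConn,
      mem_setOf_eq]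
    constructor
    · rintro ⟨h | h, hno⟩
      · obtain ⟨t, ht, h'⟩ := h; exact absurd h' (hno t ht)
      · exact ⟨fun t ht hvt => hno t ht (h.trans hvt), h⟩
    · rintro ⟨hd, hov⟩
      exact ⟨Or.inr hov, fun t ht hot => hd t ht (hov.symm.trans hot)⟩
  have hUint : ∫ ω in U, f ω ∂μ = ∫ ω in OT, f ω ∂μ + ∫ ω in D ∩ Ov, f ω ∂μ := by
    rw [← integral_inter_add_sdiff (hmeas OT) (hint f U), inter_eq_right.2 subset_union_left, hUdiff]
  have hUμ : μ.real U = μ.real OT + μ.real (D ∩ Ov) := by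
    rw [← measureReal_inter_add_sdiff (s := U) (h := measure_ne_top _ _) (hmeas OT), inter_eq_right.2 subset_union_left, hUdiff]
  -- (4) `D = Qᶜ`
  have hDQ : D = Qᶜ := by
    ext ω
    simp [hD, hQ, openConn]
  have hDint : ∫ ω in D, f ω ∂μ = m - ∫ ω in Q, f ω ∂μ := by
    have := integral_add_compl (hmeas Q) (Integrable.of_finite (f := f) (μ := μ))
    rw [← hDQ] at this
    linarith
  have hDμ : μ.real D = 1 - μ.real Q := by
    have h1 : μ.real (univ : Set (BondConfig V)) = μ.real (univ ∩ Q) + μ.real (univ \ Q) :=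
      (measureReal_inter_add_sdiff (s := univ) (h := measure_ne_top _ _) (hmeas Q)).symm
    rw [probReal_univ, univ_inter, ← compl_eq_univ_sdiff, ← hDQ] at h1
    linarith
  -- assemble (as in `surplusTransfer_single`)
  have hA : ∫ ω in OT, f ω ∂μ - μ.real OT * m ≥ μ.real (D ∩ Ov) * m - ∫ ω in D ∩ Ov, f ω ∂μ := by
    rw [hUint, hUμ] at hHarris
    linarith
  have hB : μ.real D * (μ.real (D ∩ Ov) * m - ∫ ω in D ∩ Ov, f ω ∂μ) ≥
      μ.real D * (μ.real (D ∩ Ov) * m) - μ.real (D ∩ Ov) * ∫ ω in D, f ω ∂μ := by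
    rw [mul_sub]
    linarith [hBHK]
  have hC := mul_le_mul_of_nonneg_left hA (hn D)
  rw [hDint, hDμ] at hB
  rw [hDμ] at hC ⊢
  nlinarith [hB, hC, hn (D ∩ Ov), hn Q]

end Summit.CriticalPhenomena.PercolationContinuityZ3.Theorems.AGloc

end
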